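import Summits.BirchSwinnertonDyer.BirchSwinnertonDyer.Theorems.KimAtThreeShallowEqDeepRiderOfWeightedCompat
import HarnessLib

/-!
# Route `KimAtThreeKolyvagin` (W2): the WEIGHTED defined-Kato package (C1ₑₓʷ) of the non-additive
# non-anomalous `t = 0` rows of 19599 / 19077 — (C1′₂), the unlocked port and the rows BY NAME

Cell `bsd-addord`, seat `bsd-addord-w2-c4` (gen 11; OWNER of crux 19599, item 19077).  `--supports` 19077
(helper).  HONEST FRAMING: TOOL THEOREMS WITH DISPLAYED HYPOTHESES (no definition, no named fact, no instance,
no `sorry`); the package is DISPLAYED; nothing asserted about any curve; nothing booked; 19560 / 19599 / 19077 /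
20396 stay OPEN; BSD is not proved by any of this.  Sequel of `KimAtThreeShallowEqDeepRiderOfWeightedCompat`
(the parity rider); consumers are this seat's gen 10 `…MultTwoExpFineKato` / `…MultOfDefinedKato`.

(C1ₑₓʷ) := support item 20396's (C1ₑₓ¹ᵘ) — `(ι, κK, Λ, φ)` with R-κ, `hker`, `hdual`, `ZetaBody` — with the
compatibility clause COMPAT₁ (`b = 1` at every level) REPLACED by `∃ θ` (admissible weights: `1 ⊗ θ_r ∈ L_int`,
`(1 ⊗ θ_r)²·l₀ = 3 ⊗ 1`) `∧` COMPATW₁ (`(1 ⊗ θ_r)·3·(φ(h) ⊗ 1 − Λ_{0,r}(y)) ∈ 3^{j+1}·L_int`).  It is what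
Kato's system with the DEFINED exp* satisfies at every level (tame: `θ_r = 1`, `3·exp*_w ⊆ 𝒪_w`; wild:
`θ_r = 1 − ζ₃`, `3(1 − ζ₃)·exp*_w ⊆ 𝒪_w`), whereas (C1ₑₓ¹ᵘ)'s `b = 1` fails at the ramified places of a wild
level on ordinary rows (sibling file's docstring); and (C1ₑₓ¹ᵘ) ⟹ (C1ₑₓʷ) trivially, so the registered item
still discharges everything here.
* §3 `definedKatoWeighted_of_definedKatoUnit` — (C1ₑₓ¹ᵘ) ⟹ (C1ₑₓʷ) (`θ_r := 1`);
  **`fineKato₁₂_of_definedKatoWeighted`** — (C1ₑₓʷ) at a `t = 0` row ⟹ gen 10's (C1′₂) (riders at `(1, e)`,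
  `e = 1 + λ₀ ≥ 0`, by `rider₂_of_weightedCompat` at `(a, b, t) = (1, 1, 0)`; NO digit lost).
* §4 `portUnlockedTwoExp_…`, `shallowEqDeep_row_…`, `leaf_row_…`, `lower_row_of_definedKatoWeighted_of_nonanomalous`
  — the unlocked two-exponent port and the rows of 19599 / 19077 / LEAF / 19679 at a non-additive
  NON-ANOMALOUS `t = 0` tower row ⟸ PUB ∧ non-anomaly ∧ (C1ₑₓʷ) ALONE (gen 10's `…_of_fineKato₁₂_…` on §3).
READING (08-28): the non-additive non-anomalous `t = 0` rows of 19599 / 19077 rest on (C1ₑₓʷ); (C1ₑₓʷ) ⟸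
hKatoV2ᵘ + R-κ + (S5a) + (S5b-tower) modulo the two per-factor lattice bounds `3·exp*_w ⊆ 𝒪_w` (tame `w`;
w2-c3 gen 8's `hLat_of_facts` engine at the sharp radius) and `3(1 − ζ₃)·exp*_w ⊆ 𝒪_w` (wild `w`; needs the
tame-ramification trace lemma `Tr_{L_w/ℚ₃}(x·𝒪_w) ⊆ ℤ₃ ⇒ (1 − ζ₃)x ∈ 𝒪_w`, not in the tree).
References: [BlochKato1990] §3 (Prop. 3.8, Ex. 3.11); [Kato2004Asterisque] (8.1.3), §9.4, Thm. 9.7, Thm. 6.6 (1),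
Ex. 13.3; [Kim2022StructureSelmer] §3.2.3, Lemma 3.3/3.10/3.11, Thm. 3.13; [MazurRubin2004] App. A;
[Sakamoto2024] Thm. 4.4; memo HOME/w2c4/W2C4-WEIGHTED-COMPAT-g11.md.
-/

set_option autoImplicit false
-- the Theorems namespace of a single-conjunct summit repeats the summit name by design (D-0017)
set_option linter.dupNamespace false

noncomputable section

open scoped NumberField TensorProduct ContRepresentation Classical
open CategoryTheory Field Function Finset IsDedekindDomain NumberField WeierstrassCurve
open Rat.HeightOneSpectrum
open Literature.NumberTheory.GaloisRepresentations Literature.NumberTheory.GaloisCohomology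
open Literature.NumberTheory.GaloisRepresentations.DiscreteGaloisModule
open Literature.NumberTheory.EllipticCurves Literature.NumberTheory.EllipticCurves.ModularForms
open Literature.NumberTheory.EllipticCurves.Rank1Residual
open Literature.NumberTheory.EllipticCurves.Kato2004
open Literature.NumberTheory.EllipticCurves.Kato2004.EulerSystemValues
open Summit.BirchSwinnertonDyer.Rank1Residual.GaloisImage
open Summit.BirchSwinnertonDyer.Rank1Residual.Additive.LocalLog
open Summit.BirchSwinnertonDyer.BirchSwinnertonDyer.Theorems
open Summit.BirchSwinnertonDyer.BirchSwinnertonDyer.Theorems.KimAtThreeKolyvaginDefs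
open Summit.BirchSwinnertonDyer.BirchSwinnertonDyer.Theorems.KimAtThreeDeepUpperLocalLatticeUniform
open Summit.BirchSwinnertonDyer.BirchSwinnertonDyer.Theorems.KimAtThreeDeepUpperRiderOfCompat
open Summit.BirchSwinnertonDyer.BirchSwinnertonDyer.Theorems.KimAtThreeShallowEqDeepMultTwoExpFineKato
open Summit.BirchSwinnertonDyer.BirchSwinnertonDyer.Theorems.KimAtThreeShallowEqDeepMultOfDefinedKato
open Summit.BirchSwinnertonDyer.BirchSwinnertonDyer.Theorems.KimAtThreeShallowEqDeepRiderOfWeightedCompat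

namespace Summit.BirchSwinnertonDyer.BirchSwinnertonDyer.Theorems.KimAtThreeShallowEqDeepOffStratumOfDefinedKatoWeighted

/-- Local notation: the TWO-EXPONENT rider clause (ii₂) at depth `j`, torsion slot `t`, defect exponent `e`,
place `v`, for the pair `(Λ, Λf)` (seat acc6's RIDER₂, VERBATIM). -/
local notation3 (prettyPrint := false) "RIDER₂⟦" W' ", " j ", " t' ", " e' ", " v' ", " Λ' ", " Λf "⟧" =>
  ∀ (r : Finset (HeightOneSpectrum (𝓞 ℚ)))
    (Ψ : H1 (tateRep W' 3) (cycSubgroup 3 0 r) →+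
      continuousCohomology 1
        (subgroupRep (WeierstrassCurve.torsionGaloisModule W' (((3 : ℕ) : ℤ) ^ j * ((3 : ℕ) : ℤ))).toTopRep
          (cycSubgroup 3 0 r))),
    (∀ (φ : contOneCocycles (subgroupRep (tateRep W' 3).toTopRep (cycSubgroup 3 0 r)))
        (ψ : contOneCocycles
          (subgroupRep (WeierstrassCurve.torsionGaloisModule W' (((3 : ℕ) : ℤ) ^ j * ((3 : ℕ) : ℤ))).toTopRep
            (cycSubgroup 3 0 r))),
        (∀ g, ((ψ.1 g : geomTorsion W' (((3 : ℕ) : ℤ) ^ j * ((3 : ℕ) : ℤ))) : geomPoints W') =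
          TateModule.proj 3 (j + 1) (φ.1 g)) →
        Ψ (oneCocycleClass _ φ) = oneCocycleClass _ ψ) →
    ∀ (y : H1 (tateRep W' 3) (cycSubgroup 3 0 r))
      (κ₀ : galoisCohomology (WeierstrassCurve.torsionGaloisModule W' (((3 : ℕ) : ℤ) ^ j * ((3 : ℕ) : ℤ))) 1)
      (s : ℤ_[3]),
      resSubgroup (WeierstrassCurve.torsionGaloisModule W' (((3 : ℕ) : ℤ) ^ j * ((3 : ℕ) : ℤ))).toTopRep
          (cycSubgroup 3 0 r) 1 κ₀ = Ψ y →
      galoisCohomology.localization (WeierstrassCurve.torsionGaloisModule W' (((3 : ℕ) : ℤ) ^ j * ((3 : ℕ) : ℤ)))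
          (Sum.inr v') 1 κ₀ ∈ propagatedSelmerStructure W' 3 j (Sum.inr v') →
      (∃ l ∈ cycIntLattice 3 (cycLevel 3 0 r),
          (((3 : ℕ) : ℤ_[3]) ^ t') • Λ' 0 r y - ((s : ℚ_[3]) ⊗ₜ[ℚ] (1 : CyclotomicField (cycLevel 3 0 r) ℚ)) =
            (((3 : ℕ) : ℤ_[3]) ^ (j + 1)) • (l : ℚ_[3] ⊗[ℚ] CyclotomicField (cycLevel 3 0 r) ℚ)) →
      ((3 ^ e' : ℕ) : ZMod (3 ^ (j + 1))) *
        Λf (galoisCohomology.localization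
          (WeierstrassCurve.torsionGaloisModule W' (((3 : ℕ) : ℤ) ^ j * ((3 : ℕ) : ℤ))) (Sum.inr v') 1 κ₀) =
        PadicInt.toZModPow (j + 1) s

/-- Local notation: the crude compatibility X1-int at depth `j` WITH EXPONENT `b` between Kato's value datum
`Λ_{0,r}` and the scalar dual exponential `φ` at `v` (seat w2-c3's X1-int_b text, VERBATIM). -/
local notation3 (prettyPrint := false) "COMPAT⟦" W' ", " j ", " v' ", " Λ' ", " φ0 ", " b "⟧" =>
  ∀ (r : Finset (HeightOneSpectrum (𝓞 ℚ)))
    (Ψ : H1 (tateRep W' 3) (cycSubgroup 3 0 r) →+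
      continuousCohomology 1 (subgroupRep
        (WeierstrassCurve.torsionGaloisModule W' (((3 : ℕ) : ℤ) ^ j * ((3 : ℕ) : ℤ))).toTopRep (cycSubgroup 3 0 r))),
    (∀ (φ₁ : contOneCocycles (subgroupRep (tateRep W' 3).toTopRep (cycSubgroup 3 0 r)))
        (ψ : contOneCocycles (subgroupRep
          (WeierstrassCurve.torsionGaloisModule W' (((3 : ℕ) : ℤ) ^ j * ((3 : ℕ) : ℤ))).toTopRep (cycSubgroup 3 0 r))),
        (∀ g, ((ψ.1 g : geomTorsion W' (((3 : ℕ) : ℤ) ^ j * ((3 : ℕ) : ℤ))) : geomPoints W') =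
          TateModule.proj 3 (j + 1) (φ₁.1 g)) →
        Ψ (oneCocycleClass _ φ₁) = oneCocycleClass _ ψ) →
    ∀ (y : H1 (tateRep W' 3) (cycSubgroup 3 0 r))
      (κ₀ : galoisCohomology (WeierstrassCurve.torsionGaloisModule W' (((3 : ℕ) : ℤ) ^ j * ((3 : ℕ) : ℤ))) 1)
      (h : (tateLocalRep W' 3 (Sum.inr v')).cohomology 1),
      resSubgroup (WeierstrassCurve.torsionGaloisModule W' (((3 : ℕ) : ℤ) ^ j * ((3 : ℕ) : ℤ))).toTopRep
          (cycSubgroup 3 0 r) 1 κ₀ = Ψ y →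
      galoisCohomology.localization (WeierstrassCurve.torsionGaloisModule W' (((3 : ℕ) : ℤ) ^ j * ((3 : ℕ) : ℤ)))
          (Sum.inr v') 1 κ₀ = tateLocalMap W' 3 j (Sum.inr v') h →
      ∃ l ∈ cycIntLattice 3 (cycLevel 3 0 r),
        (((3 : ℕ) : ℤ_[3]) ^ b) • ((φ0 h ⊗ₜ[ℚ] (1 : CyclotomicField (cycLevel 3 0 r) ℚ)) - Λ' 0 r y) =
          (((3 : ℕ) : ℤ_[3]) ^ (j + 1)) • (l : ℚ_[3] ⊗[ℚ] CyclotomicField (cycLevel 3 0 r) ℚ)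

/-- Local notation: **the WEIGHTED compatibility** at depth `j` with exponent `b` and weights `θ_r ∈ ℚ(ζ_m)`:
`∃ l ∈ L_int, (1 ⊗ θ_r)·3^b·(φ(h) ⊗ 1 − Λ_{0,r}(y)) = 3^{j+1}·l` (X1-int_b is the case `θ_r = 1`). -/
local notation3 (prettyPrint := false) "COMPATW⟦" W' ", " j ", " v' ", " Λ' ", " φ0 ", " b ", " θ' "⟧" =>
  ∀ (r : Finset (HeightOneSpectrum (𝓞 ℚ)))
    (Ψ : H1 (tateRep W' 3) (cycSubgroup 3 0 r) →+
      continuousCohomology 1 (subgroupRep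
        (WeierstrassCurve.torsionGaloisModule W' (((3 : ℕ) : ℤ) ^ j * ((3 : ℕ) : ℤ))).toTopRep (cycSubgroup 3 0 r))),
    (∀ (φ₁ : contOneCocycles (subgroupRep (tateRep W' 3).toTopRep (cycSubgroup 3 0 r)))
        (ψ : contOneCocycles (subgroupRep
          (WeierstrassCurve.torsionGaloisModule W' (((3 : ℕ) : ℤ) ^ j * ((3 : ℕ) : ℤ))).toTopRep (cycSubgroup 3 0 r))),
        (∀ g, ((ψ.1 g : geomTorsion W' (((3 : ℕ) : ℤ) ^ j * ((3 : ℕ) : ℤ))) : geomPoints W') =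
          TateModule.proj 3 (j + 1) (φ₁.1 g)) →
        Ψ (oneCocycleClass _ φ₁) = oneCocycleClass _ ψ) →
    ∀ (y : H1 (tateRep W' 3) (cycSubgroup 3 0 r))
      (κ₀ : galoisCohomology (WeierstrassCurve.torsionGaloisModule W' (((3 : ℕ) : ℤ) ^ j * ((3 : ℕ) : ℤ))) 1)
      (h : (tateLocalRep W' 3 (Sum.inr v')).cohomology 1),
      resSubgroup (WeierstrassCurve.torsionGaloisModule W' (((3 : ℕ) : ℤ) ^ j * ((3 : ℕ) : ℤ))).toTopRep
          (cycSubgroup 3 0 r) 1 κ₀ = Ψ y →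
      galoisCohomology.localization (WeierstrassCurve.torsionGaloisModule W' (((3 : ℕ) : ℤ) ^ j * ((3 : ℕ) : ℤ)))
          (Sum.inr v') 1 κ₀ = tateLocalMap W' 3 j (Sum.inr v') h →
      ∃ l ∈ cycIntLattice 3 (cycLevel 3 0 r),
        ((1 : ℚ_[3]) ⊗ₜ[ℚ] (θ' r : CyclotomicField (cycLevel 3 0 r) ℚ)) *
            ((((3 : ℕ) : ℤ_[3]) ^ b) • ((φ0 h ⊗ₜ[ℚ] (1 : CyclotomicField (cycLevel 3 0 r) ℚ)) - Λ' 0 r y)) =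
          (((3 : ℕ) : ℤ_[3]) ^ (j + 1)) • (l : ℚ_[3] ⊗[ℚ] CyclotomicField (cycLevel 3 0 r) ℚ)

/-- Local notation: **admissible weights** — at every level `r`, `1 ⊗ θ_r ∈ L_int` and `(1 ⊗ θ_r)²·l₀ = 3 ⊗ 1`
for some `l₀ ∈ L_int` (so `θ_r² ∣ 3` in `ℤ₃ ⊗ ℤ[ζ_m]`: `θ_r = 1`, or `θ_r = 1 − ζ₃` when `3 ∣ m`). -/
local notation3 (prettyPrint := false) "WEIGHT⟦" θ' "⟧" =>
  ∀ r : Finset (HeightOneSpectrum (𝓞 ℚ)),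
    ((1 : ℚ_[3]) ⊗ₜ[ℚ] (θ' r : CyclotomicField (cycLevel 3 0 r) ℚ)) ∈ cycIntLattice 3 (cycLevel 3 0 r) ∧
    ∃ l₀ ∈ cycIntLattice 3 (cycLevel 3 0 r),
      ((1 : ℚ_[3]) ⊗ₜ[ℚ] (θ' r : CyclotomicField (cycLevel 3 0 r) ℚ)) *
          ((1 : ℚ_[3]) ⊗ₜ[ℚ] (θ' r : CyclotomicField (cycLevel 3 0 r) ℚ)) * l₀ =
        ((3 : ℕ) : ℚ_[3]) ⊗ₜ[ℚ] (1 : CyclotomicField (cycLevel 3 0 r) ℚ)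

/-- Local notation: **(C1ₑₓʷ) at the row `(W, v, P)`** — the DEFINED-KATO package with R-κ, `hker`, `hdual`,
admissible weights `θ`, the WEIGHTED compatibility COMPATW₁ at every depth, and Kato's `ZetaBody` family. -/
local notation3 (prettyPrint := false) "DEFKATOW⟦" W' ", " v' ", " N' ", " P' "⟧" =>
  ∃ (ι : (n : ℕ) → (CyclotomicField n ℚ →+* ℂ)) (κK : ℝ)
    (Λ : ∀ (k' : ℕ) (r : Finset (HeightOneSpectrum (𝓞 ℚ))),
      H1 (tateRep W' 3) (cycSubgroup 3 k' r) →ₗ[ℤ_[3]] ℚ_[3] ⊗[ℚ] CyclotomicField (cycLevel 3 k' r) ℚ)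
    (φ : (tateLocalRep W' 3 (Sum.inr v')).cohomology 1 →+ ℚ_[3])
    (θ : ∀ r : Finset (HeightOneSpectrum (𝓞 ℚ)), CyclotomicField (cycLevel 3 0 r) ℚ),
    κK ≠ 0 ∧ (∃ u : ℚ, (u : ℝ) = κK ∧ padicValRat 3 u = 0) ∧
    (∀ y, φ y = 0 ↔ ∀ j : ℕ, tateLocalMap W' 3 j (Sum.inr v') y ∈
      WeierstrassCurve.kummerSelmerStructure W' (((3 : ℕ) : ℤ) ^ j * ((3 : ℕ) : ℤ)) (Sum.inr v')) ∧
    (∀ a : ℚ_[3], (∃ y, φ y = a) ↔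
      ∀ Q : ((W' : WeierstrassCurve ℚ).baseChange ℚ_[3]).toAffine.Point,
        ‖a * padicLog ((W' : WeierstrassCurve ℚ).baseChange ℚ_[3]) Q‖ ≤ 1) ∧
    WEIGHT⟦θ⟧ ∧
    (∀ j : ℕ, COMPATW⟦W', j, v', Λ, φ, 1, θ⟧) ∧
    ∀ (c d a : ℤ) (A : ℕ), 0 < A → Int.gcd c (6 * 3 * A) = 1 → Int.gcd d (6 * 3 * N') = 1 →
      ∃ (z : ∀ (k' : ℕ) (r : (cyclotomicLevelsRat 3 (badPlaces c d A N')).Ideals),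
            H1 (tateRep W' 3) ((cyclotomicLevelsRat 3 (badPlaces c d A N')).level k' r.1))
        (x : ∀ (k' : ℕ) (r : (cyclotomicLevelsRat 3 (badPlaces c d A N')).Ideals),
            CyclotomicField (cycLevel 3 k' r.1) ℚ),
        ZetaBody W' 3 (P' : ModularParametrizationData W' N').f ι κK Λ c d a A z x

/-- Local notation: **(C1ₑₓ¹ᵘ) at the row `(W, v, P)`** (gen 10's `KimAtThreeShallowEqDeepMultOfDefinedKato`,
VERBATIM; = registered support item 20396 read at the row). -/
local notation3 (prettyPrint := false) "DEFKATO₁ᵘ⟦" W' ", " v' ", " N' ", " P' "⟧" =>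
  ∃ (ι : (n : ℕ) → (CyclotomicField n ℚ →+* ℂ)) (κK : ℝ)
    (Λ : ∀ (k' : ℕ) (r : Finset (HeightOneSpectrum (𝓞 ℚ))),
      H1 (tateRep W' 3) (cycSubgroup 3 k' r) →ₗ[ℤ_[3]] ℚ_[3] ⊗[ℚ] CyclotomicField (cycLevel 3 k' r) ℚ)
    (φ : (tateLocalRep W' 3 (Sum.inr v')).cohomology 1 →+ ℚ_[3]),
    κK ≠ 0 ∧ (∃ u : ℚ, (u : ℝ) = κK ∧ padicValRat 3 u = 0) ∧
    (∀ y, φ y = 0 ↔ ∀ j : ℕ, tateLocalMap W' 3 j (Sum.inr v') y ∈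
      WeierstrassCurve.kummerSelmerStructure W' (((3 : ℕ) : ℤ) ^ j * ((3 : ℕ) : ℤ)) (Sum.inr v')) ∧
    (∀ a : ℚ_[3], (∃ y, φ y = a) ↔
      ∀ Q : ((W' : WeierstrassCurve ℚ).baseChange ℚ_[3]).toAffine.Point,
        ‖a * padicLog ((W' : WeierstrassCurve ℚ).baseChange ℚ_[3]) Q‖ ≤ 1) ∧
    (∀ j : ℕ, COMPAT⟦W', j, v', Λ, φ, 1⟧) ∧
    ∀ (c d a : ℤ) (A : ℕ), 0 < A → Int.gcd c (6 * 3 * A) = 1 → Int.gcd d (6 * 3 * N') = 1 →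
      ∃ (z : ∀ (k' : ℕ) (r : (cyclotomicLevelsRat 3 (badPlaces c d A N')).Ideals),
            H1 (tateRep W' 3) ((cyclotomicLevelsRat 3 (badPlaces c d A N')).level k' r.1))
        (x : ∀ (k' : ℕ) (r : (cyclotomicLevelsRat 3 (badPlaces c d A N')).Ideals),
            CyclotomicField (cycLevel 3 k' r.1) ℚ),
        ZetaBody W' 3 (P' : ModularParametrizationData W' N').f ι κK Λ c d a A z x

/-- Local notation: **(C1′₂) at the row `(W, v, P)`** (gen 10's `KimAtThreeShallowEqDeepMultTwoExpFineKato`,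
VERBATIM). -/
local notation3 (prettyPrint := false) "FINEKATO₁₂⟦" W' ", " v' ", " N' ", " P' "⟧" =>
  ∀ [ContinuousSMul ℤ_[3] (WeierstrassCurve.tateModule W' 3)] [Module.Free ℤ_[3] (WeierstrassCurve.tateModule W' 3)]
    [Module.Finite ℤ_[3] (WeierstrassCurve.tateModule W' 3)],
    ∃ (ι : (n : ℕ) → (CyclotomicField n ℚ →+* ℂ)) (κK : ℝ)
      (Λ : ∀ (k' : ℕ) (r : Finset (HeightOneSpectrum (𝓞 ℚ))),
        H1 (tateRep W' 3) (cycSubgroup 3 k' r) →ₗ[ℤ_[3]]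
          ℚ_[3] ⊗[ℚ] CyclotomicField (cycLevel 3 k' r) ℚ)
      (Λfin : ∀ j : ℕ, galoisCohomology
        ((WeierstrassCurve.torsionGaloisModule W' (((3 : ℕ) : ℤ) ^ j * ((3 : ℕ) : ℤ))).toLocal (Sum.inr v')) 1 →+
          ZMod (3 ^ (j + 1))) (e : ℕ),
      κK ≠ 0 ∧ (∃ u : ℚ, (u : ℝ) = κK ∧ padicValRat 3 u = 0) ∧
      (∀ j : ℕ,
        (∀ c : ZMod (3 ^ (j + 1)), ∃ x ∈ propagatedSelmerStructure W' 3 j (Sum.inr v'), Λfin j x = c) ∧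
        (∀ x ∈ propagatedSelmerStructure W' 3 j (Sum.inr v'),
          Λfin j x = 0 ↔ x ∈ WeierstrassCurve.kummerSelmerStructure W' (((3 : ℕ) : ℤ) ^ j * ((3 : ℕ) : ℤ)) (Sum.inr v'))) ∧
      (∀ j : ℕ, RIDER₂⟦W', j, 1, e, v', Λ, Λfin j⟧) ∧
      ∀ (c d a : ℤ) (A : ℕ), 0 < A → Int.gcd c (6 * 3 * A) = 1 → Int.gcd d (6 * 3 * N') = 1 →
        ∃ (z : ∀ (k' : ℕ) (r : (cyclotomicLevelsRat 3 (badPlaces c d A N')).Ideals),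
              H1 (tateRep W' 3) ((cyclotomicLevelsRat 3 (badPlaces c d A N')).level k' r.1))
          (x : ∀ (k' : ℕ) (r : (cyclotomicLevelsRat 3 (badPlaces c d A N')).Ideals),
              CyclotomicField (cycLevel 3 k' r.1) ℚ),
          ZetaBody W' 3 (P' : ModularParametrizationData W' N').f ι κK Λ c d a A z x

/-- Local notation: the UNLOCKED two-exponent port at `(W, v₃, η, P)`, torsion slot `0`, defect exponent `e`
(gen 7 PortRows' `hPort`, VERBATIM). -/
local notation3 (prettyPrint := false) "PORTU₂⟦" W' ", " e' ", " v' ", " η' ", " P' "⟧" =>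
  ∀ (k k' : ℕ) (Dk : KolyvaginDatum (WeierstrassCurve.torsionGaloisModule W' (((3 : ℕ) : ℤ) ^ k * ((3 : ℕ) : ℤ))))
    (Dk' : KolyvaginDatum (WeierstrassCurve.torsionGaloisModule W' (((3 : ℕ) : ℤ) ^ k' * ((3 : ℕ) : ℤ))))
    (red : (WeierstrassCurve.torsionGaloisModule W' (((3 : ℕ) : ℤ) ^ k' * ((3 : ℕ) : ℤ))).toContRepresentation →ⁱL
      (WeierstrassCurve.torsionGaloisModule W' (((3 : ℕ) : ℤ) ^ k * ((3 : ℕ) : ℤ))).toContRepresentation),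
    Dk.IsCanonicalTauDatumThreeAtWith W' k k η' → Dk'.IsCanonicalTauDatumThreeAtWith W' k' k' η' → k ≤ k' →
    (∀ x : geomTorsion W' (((3 : ℕ) : ℤ) ^ k' * ((3 : ℕ) : ℤ)),
      ((red x : geomTorsion W' (((3 : ℕ) : ℤ) ^ k * ((3 : ℕ) : ℤ))) : geomPoints W') =
        (((3 : ℕ) : ℤ) ^ (k' - k)) • (x : geomPoints W')) →
    ∃ κ Λ κ' κu Λu κu',
      KatoKuriharaWitnessAtTwoExp W' k 0 e' Dk v' P' κ Λ κ' ∧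
      KatoKuriharaWitnessAtTwoExp W' k' 0 e' Dk' v' P' κu Λu κu' ∧
      ∀ d, Dk'.IsLevel d → Dk.IsLevel d →
        galoisCohomology.map red 1 (κu d) = κ d ∧ galoisCohomology.map red 1 (κu' d) = κ' d

/-! ### §3 (C1ₑₓʷ) ⟹ (C1′₂) at a `t = 0` row; (C1ₑₓ¹ᵘ) ⟹ (C1ₑₓʷ) -/

section Row

variable (W : WeierstrassCurve ℚ) [W.IsElliptic] [W.IsGloballyMinimal]

set_option backward.isDefEq.respectTransparency false in
/-- **(C1ₑₓ¹ᵘ) ⟹ (C1ₑₓʷ)** with the trivial weights `θ_r := 1` — so the registered support item 20396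
`DefinedKatoUnitNonAdditiveThree` (read at the row) discharges the weighted package, and nothing below is a
new obligation. [folklore] -/
theorem definedKatoWeighted_of_definedKatoUnit {N : ℕ} [NeZero N] (P : ModularParametrizationData W N)
    {v₃ : HeightOneSpectrum (𝓞 ℚ)} [ContinuousSMul ℤ_[3] (W.tateModule 3)] [Module.Free ℤ_[3] (W.tateModule 3)]
    [Module.Finite ℤ_[3] (W.tateModule 3)]
    (hKU : DEFKATO₁ᵘ⟦W, v₃, N, P⟧) : DEFKATOW⟦W, v₃, N, P⟧ := by
  obtain ⟨ι, κK, Λ, φ, hκ0, hunit, hker, hdual, hcompat, hz⟩ := hKU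
  exact ⟨ι, κK, Λ, φ, fun r => (1 : CyclotomicField (cycLevel 3 0 r) ℚ), hκ0, hunit, hker, hdual,
    fun r => weight_one 3 (cycLevel 3 0 r), fun j => compatW_of_compat W v₃ Λ φ j 1 (hcompat j), hz⟩

set_option backward.isDefEq.respectTransparency false in
/-- **(C1ₑₓʷ) ⟹ (C1′₂) at a `t = 0` row.**  For a globally minimal `W`, a place `v₃ ∣ 3`, `#E(ℚ₃)[3] = 1` and
a parametrisation datum `P`: the WEIGHTED defined-Kato package — `(ι, κK, Λ, φ, θ)` with R-κ, `hker`, `hdual`,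
admissible weights, COMPATW₁ at every depth, `ZetaBody` — yields gen 10's fine package (C1′₂) with NO digit
lost: `φ = 3^{λ₀}φ′` with `λ₀ ≥ −1` (gen 10's `exists_normalised_of_dual_of_torsionBy`), the finite-level
functionals from the normalised `φ′` (w2-c3's `exists_finLevelFunctional_clauses_of_normalised`), and the
two-exponent riders at `(1, e)`, `e = 1 + λ₀`, by `rider₂_of_weightedCompat` at `(a, b, t) = (1, 1, 0)` read
back on `Λ` (gen 10's `rider₂_one_of_smul`).  The truth on a multiplicative row is `λ₀ = v₃(c₃) − 1`,
`e = v₃(c₃)`; on a good non-anomalous row `λ₀ = −1`, `e = 0`.  Nothing constructed; nothing booked.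
[cite: BlochKato1990, §3 (Prop. 3.8, Ex. 3.11)] [cite: Kim2022StructureSelmer, §3.2.3, Lemma 3.3 / 3.10 / 3.11, Thm. 3.13]
[cite: Kato2004Asterisque, §9.4 (p. 188) and Thm. 9.7 (p. 189)] [cite: MazurRubin2004, App. A, Prop. A.2] -/
theorem fineKato₁₂_of_definedKatoWeighted {N : ℕ} [NeZero N] (P : ModularParametrizationData W N)
    {v₃ : HeightOneSpectrum (𝓞 ℚ)}
    (ht : Nat.card {Q : (W.baseChange ℚ_[3]).toAffine.Point // (3 : ℕ) • Q = 0} = 1)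
    (hKW : ∀ [ContinuousSMul ℤ_[3] (W.tateModule 3)] [Module.Free ℤ_[3] (W.tateModule 3)]
      [Module.Finite ℤ_[3] (W.tateModule 3)], DEFKATOW⟦W, v₃, N, P⟧) :
    FINEKATO₁₂⟦W, v₃, N, P⟧ := by
  intro _ _ _
  obtain ⟨ι, κK, Λ, φ, θ, hκ0, hunit, hker, hdual, hθ, hcompat, hz⟩ := hKW
  -- normalise `φ = 3^{λ₀} φ′` with `λ₀ ≥ -1` (`t = 0`), transport `hker`, build `Λfin` with the (Λ)-clauses
  obtain ⟨φ', lam, hlam, hint', hsurj', hφ⟩ :=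
    exists_normalised_of_dual_of_torsionBy W 3 (Sum.inr v₃) φ hdual ht
  have hc : (3 : ℚ_[3]) ^ lam ≠ 0 := zpow_ne_zero lam (by norm_num)
  have hker' := hker_of_eq_mul W 3 (Sum.inr v₃) φ hc hφ hker
  obtain ⟨Λfin, hΛ, hI⟩ := exists_finLevelFunctional_clauses_of_normalised W 3 (Sum.inr v₃) φ' hint' hsurj' hker'
  -- the defect exponent `e = 1 + λ₀ ≥ 0`
  set e : ℕ := ((1 : ℤ) + lam).toNat with hedef
  have he : (e : ℤ) = ((0 : ℕ) : ℤ) + ((1 : ℕ) : ℤ) + lam := by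
    rw [hedef, Int.toNat_of_nonneg (by omega)]; push_cast; ring
  -- RIDER₂ at `(0, e)` for `3 • Λ` from the weighted compatibility at `b = 1`, then back to `(1, e)` for `Λ`
  have hfin₂ : ∀ j : ℕ, RIDER₂⟦W, j, 1, e, v₃, Λ, Λfin j⟧ := fun j =>
    rider₂_one_of_smul W
      (rider₂_of_weightedCompat W v₃ Λ φ φ' θ lam hφ hint' j (Λfin j) (hI j) hθ 1 (hcompat j) 1 0 e le_rfl he)
  exact ⟨ι, κK, Λ, Λfin, e, hκ0, hunit, hΛ, hfin₂, hz⟩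

/-! ### §4 The unlocked two-exponent port and the rows of W2 from (C1ₑₓʷ) + non-anomaly -/

/-- **The UNLOCKED two-exponent port at a non-additive NON-ANOMALOUS `t = 0` row FROM (C1ₑₓʷ) ALONE** —
`∃ e`, gen 7 PortSeam's `hPortOff` text at `(W, v₃, η, P)` for every generator family `η` ⟸ surj(3) ∧
`#E(ℚ₃)[3] = 1` ∧ `3 ∤ 3 + 𝟙_{3∤N} − a₃` ∧ the datum at the conductor ∧ (C1ₑₓʷ): gen 10's
`portUnlockedTwoExp_of_fineKato₁₂_of_nonanomalous` on §3.  Nothing booked.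
[cite: Kato2004Asterisque, (8.1.3) (p. 180), §9.4 (p. 188), Thm. 9.7 (p. 189), Thm. 6.6 (1) (p. 163) and Ex. 13.3 (pp. 224–225)]
[cite: Kim2022StructureSelmer, §3.2.3, Lemma 3.3 and Thm. 3.13 (arXiv v3 pp. 16–18, 26–28)] -/
theorem portUnlockedTwoExp_of_definedKatoWeighted_of_nonanomalous
    {N : ℕ} [NeZero N] (P : ModularParametrizationData W N) (hN : N = W.conductorNorm ℤ)
    (hsurj : W.HasSurjectiveModNGaloisRep ((3 : ℕ) : ℤ))
    {v₃ : HeightOneSpectrum (𝓞 ℚ)} (hv₃ : ((3 : ℕ) : 𝓞 ℚ) ∈ v₃.asIdeal)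
    (ht : Nat.card {Q : (W.baseChange ℚ_[3]).toAffine.Point // (3 : ℕ) • Q = 0} = 1)
    {t₃ : ℤ} (ht₃ : cuspCoeff P.f 3 = t₃) (h3a : ¬ (3 : ℤ) ∣ 3 + (if 3 ∣ N then 0 else 1) - t₃)
    (hKW : ∀ [ContinuousSMul ℤ_[3] (W.tateModule 3)] [Module.Free ℤ_[3] (W.tateModule 3)]
      [Module.Finite ℤ_[3] (W.tateModule 3)], DEFKATOW⟦W, v₃, N, P⟧)
    (η : (q : HeightOneSpectrum (𝓞 ℚ)) → (ZMod (Ideal.absNorm q.asIdeal))ˣ) :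
    ∃ e : ℕ, PORTU₂⟦W, e, v₃, η, P⟧ :=
  portUnlockedTwoExp_of_fineKato₁₂_of_nonanomalous W P hN hsurj hv₃ ht ht₃ h3a
    (fineKato₁₂_of_definedKatoWeighted W P ht hKW) η

/-- **SHALLOW = DEEP (19599 / 19077's conclusion) AT a non-additive NON-ANOMALOUS `t = 0` TOWER ROW with the
datum at the conductor, FROM PUB + (C1ₑₓʷ) ALONE** — [S24] Thm 4.4 (1)(2), GZK, Poitou–Tate (by name), the
`3`-adic tower, `#E(ℚ₃)[3] = 1`, `3`-integral plus symbols, `ord(δ̃) = 0`, `v₃`, `η`, the non-anomaly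
certificate and (C1ₑₓʷ) for `D.f`.  Nothing booked. [cite: Kim2025RefinedTNC, Thm 1.2]
[cite: Kim2022StructureSelmer, Thm. 1.9 (6), Thm. 3.13] [cite: Sakamoto2024, Thm. 4.4 (p. 926)]
[cite: MazurRubin2004, Thm. 5.2.12] [cite: Kato2004Asterisque, Thm. 9.7 (p. 189)] -/
theorem shallowEqDeep_row_of_definedKatoWeighted_of_nonanomalous
    (hS24 : Sakamoto2024.kolyvaginSystems_freeRankOne_zmod_three_pow)
    (hS24₂ : Sakamoto2024.kolyvaginSystems_idealOfBasis_eq_fittingIdeal_zmod_three_pow)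
    (hGZK : rank_eq_analyticRank_of_analyticRank_le_one) (hPT : poitouTate_selmerStructure_duality ℚ)
    (htower : ∀ m : ℕ, W.HasSurjectiveModNGaloisRep (3 ^ m : ℕ))
    (ht : Nat.card {Q : (W.baseChange ℚ_[3]).toAffine.Point // (3 : ℕ) • Q = 0} = 1)
    {N : ℕ} [NeZero N] (D : ModularParametrizationData W N) (hN : N = W.conductorNorm ℤ)
    (hint : ∀ r : ℚ, ratPlusSymbol D.f r ≠ 0 → 0 ≤ padicValRat 3 (ratPlusSymbol D.f r))
    (hord : kuriharaVanishingOrder W 3 D.f = 0)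
    (v₃ : HeightOneSpectrum (𝓞 ℚ)) (hv₃ : ((3 : ℕ) : 𝓞 ℚ) ∈ v₃.asIdeal)
    (η : (q : HeightOneSpectrum (𝓞 ℚ)) → (ZMod (Ideal.absNorm q.asIdeal))ˣ)
    (hη : ∀ q : HeightOneSpectrum (𝓞 ℚ), Subgroup.zpowers (η q) = ⊤)
    {t₃ : ℤ} (ht₃ : cuspCoeff D.f 3 = t₃) (h3a : ¬ (3 : ℤ) ∣ 3 + (if 3 ∣ N then 0 else 1) - t₃)
    (hKW : ∀ [ContinuousSMul ℤ_[3] (W.tateModule 3)] [Module.Free ℤ_[3] (W.tateModule 3)]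
      [Module.Finite ℤ_[3] (W.tateModule 3)], DEFKATOW⟦W, v₃, N, D⟧) :
    kuriharaPartialDeepInfty W 3 D.f ≤ kuriharaPartialInfty W 3 D.f :=
  shallowEqDeep_row_of_fineKato₁₂_of_nonanomalous W hS24 hS24₂ hGZK hPT htower ht D hN hint hord v₃ hv₃ η hη
    ht₃ h3a (fineKato₁₂_of_definedKatoWeighted W D ht hKW)

/-- **The LEAF row (`N11.KimAtThreeRankZeroPUB` at the row) AT a non-additive NON-ANOMALOUS `t = 0` TOWER ROW,
FROM PUB + (C1ₑₓʷ) ALONE** — same displayed inputs.  Nothing booked; BSD is not proved by this.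
[cite: Kim2025RefinedTNC, Thm 1.1] [cite: Kim2022StructureSelmer, Thm. 1.9 (6)] [cite: Sakamoto2024, Thm. 4.4 (p. 926)] -/
theorem leaf_row_of_definedKatoWeighted_of_nonanomalous
    (hS24 : Sakamoto2024.kolyvaginSystems_freeRankOne_zmod_three_pow)
    (hS24₂ : Sakamoto2024.kolyvaginSystems_idealOfBasis_eq_fittingIdeal_zmod_three_pow)
    (hGZK : rank_eq_analyticRank_of_analyticRank_le_one) (hPT : poitouTate_selmerStructure_duality ℚ)
    (htower : ∀ m : ℕ, W.HasSurjectiveModNGaloisRep (3 ^ m : ℕ))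
    (ht : Nat.card {Q : (W.baseChange ℚ_[3]).toAffine.Point // (3 : ℕ) • Q = 0} = 1)
    {N : ℕ} [NeZero N] (D : ModularParametrizationData W N) (hN : N = W.conductorNorm ℤ)
    (hint : ∀ r : ℚ, ratPlusSymbol D.f r ≠ 0 → 0 ≤ padicValRat 3 (ratPlusSymbol D.f r))
    (hord : kuriharaVanishingOrder W 3 D.f = 0)
    (v₃ : HeightOneSpectrum (𝓞 ℚ)) (hv₃ : ((3 : ℕ) : 𝓞 ℚ) ∈ v₃.asIdeal)
    (η : (q : HeightOneSpectrum (𝓞 ℚ)) → (ZMod (Ideal.absNorm q.asIdeal))ˣ)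
    (hη : ∀ q : HeightOneSpectrum (𝓞 ℚ), Subgroup.zpowers (η q) = ⊤)
    {t₃ : ℤ} (ht₃ : cuspCoeff D.f 3 = t₃) (h3a : ¬ (3 : ℤ) ∣ 3 + (if 3 ∣ N then 0 else 1) - t₃)
    (hKW : ∀ [ContinuousSMul ℤ_[3] (W.tateModule 3)] [Module.Free ℤ_[3] (W.tateModule 3)]
      [Module.Finite ℤ_[3] (W.tateModule 3)], DEFKATOW⟦W, v₃, N, D⟧) :
    ∃ dd : ℕ, kuriharaPartialInfty W 3 D.f = dd ∧
      kuriharaPartial W 3 D.f 0 =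
        ((padicValNat 3 (Nat.card (AddCommGroup.primaryComponent W.sha 3)) + dd : ℕ) : ℕ∞) :=
  leaf_row_of_fineKato₁₂_of_nonanomalous W hS24 hS24₂ hGZK hPT htower ht D hN hint hord v₃ hv₃ η hη ht₃ h3a
    (fineKato₁₂_of_definedKatoWeighted W D ht hKW)

/-- **The LOWER row (19679 / 19075's conclusion) AT a non-additive NON-ANOMALOUS `t = 0` TOWER ROW, FROM PUB +
(C1ₑₓʷ) ALONE** — same displayed inputs.  Nothing booked.
[cite: Kim2022StructureSelmer, Thm. 1.9 (6), §1.5.1] [cite: MazurRubin2004, Def. 5.2.11, Thm. 5.2.12 (i)] [cite: Sakamoto2024, Thm. 4.4 (p. 926)] -/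
theorem lower_row_of_definedKatoWeighted_of_nonanomalous
    (hS24 : Sakamoto2024.kolyvaginSystems_freeRankOne_zmod_three_pow)
    (hS24₂ : Sakamoto2024.kolyvaginSystems_idealOfBasis_eq_fittingIdeal_zmod_three_pow)
    (hGZK : rank_eq_analyticRank_of_analyticRank_le_one) (hPT : poitouTate_selmerStructure_duality ℚ)
    (htower : ∀ m : ℕ, W.HasSurjectiveModNGaloisRep (3 ^ m : ℕ))
    (ht : Nat.card {Q : (W.baseChange ℚ_[3]).toAffine.Point // (3 : ℕ) • Q = 0} = 1)
    {N : ℕ} [NeZero N] (D : ModularParametrizationData W N) (hN : N = W.conductorNorm ℤ)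
    (hint : ∀ r : ℚ, ratPlusSymbol D.f r ≠ 0 → 0 ≤ padicValRat 3 (ratPlusSymbol D.f r))
    (hord : kuriharaVanishingOrder W 3 D.f = 0)
    (v₃ : HeightOneSpectrum (𝓞 ℚ)) (hv₃ : ((3 : ℕ) : 𝓞 ℚ) ∈ v₃.asIdeal)
    (η : (q : HeightOneSpectrum (𝓞 ℚ)) → (ZMod (Ideal.absNorm q.asIdeal))ˣ)
    (hη : ∀ q : HeightOneSpectrum (𝓞 ℚ), Subgroup.zpowers (η q) = ⊤)
    {t₃ : ℤ} (ht₃ : cuspCoeff D.f 3 = t₃) (h3a : ¬ (3 : ℤ) ∣ 3 + (if 3 ∣ N then 0 else 1) - t₃)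
    (hKW : ∀ [ContinuousSMul ℤ_[3] (W.tateModule 3)] [Module.Free ℤ_[3] (W.tateModule 3)]
      [Module.Finite ℤ_[3] (W.tateModule 3)], DEFKATOW⟦W, v₃, N, D⟧) :
    ∃ dd : ℕ, kuriharaPartialDeepInfty W 3 D.f = dd ∧
      kuriharaPartial W 3 D.f 0 ≤
        ((padicValNat 3 (Nat.card (AddCommGroup.primaryComponent W.sha 3)) + dd : ℕ) : ℕ∞) :=
  lower_row_of_fineKato₁₂_of_nonanomalous W hS24 hS24₂ hGZK hPT htower ht D hN hint hord v₃ hv₃ η hη ht₃ h3a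
    (fineKato₁₂_of_definedKatoWeighted W D ht hKW)

end Row

end Summit.BirchSwinnertonDyer.BirchSwinnertonDyer.Theorems.KimAtThreeShallowEqDeepOffStratumOfDefinedKatoWeighted

end
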